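import Summits.Ventures.HodgeRepro2.T5SU11ResolventEigenfunction
import Summits.Ventures.HodgeRepro2.T5SU11KernelCompositionDerivative

/-!
# The sharp disc of the Neumann series is exact on the ground state: `Σ (μ − μ₂)^k (G^I_{λ₂})^{k+1} Ξ` converges iff
`|μ − μ₂| < (λ₂ − 1)²`

Row 4xx's eigen-relation `G^I_λ Ξ = −Ξ/(μ + 1) = −Ξ/(λ − 1)²` (`greenSolI_sph_one_eq`) iterates to
`(G^I_λ)^k Ξ = (−1/(λ − 1)²)^k Ξ` on `(0, ∞)`, so on the ground state the Neumann series of row 559,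
`Σ_k (μ − μ₂)^k (G^I_{λ₂})^{k+1} Ξ(t)`, is the GEOMETRIC series `−Ξ(t)/(λ₂ − 1)² · Σ_k (−(μ − μ₂)/(λ₂ − 1)²)^k`:

* `iterate_sph_one` — **`(G^I_λ)^k Ξ(t) = (−1/(μ + 1))^k Ξ(t)`** for `t > 0`;
* `neumann_sph_one_term` — the `k`-th Neumann term on `Ξ` is `−Ξ(t)/(μ₂ + 1) · (−(μ − μ₂)/(μ₂ + 1))^k`;
* `summable_neumann_sph_one_iff` — **the Neumann series on `Ξ` is summable IF AND ONLY IF `|μ − μ₂| < (λ₂ − 1)²`**: the sharp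
  disc of rows 559 / 587 / 591 is EXACTLY the disc of convergence on the ground state — the radius `dist(μ₂, −ρ²)` cannot be
  improved on `W_1`;
* `not_summable_neumann_sph_one` — divergence for `|μ − μ₂| > (λ₂ − 1)²`;
* `hasSum_neumann_sph_one`, `tsum_neumann_sph_one` — inside the disc the sum is `−Ξ(t)/(μ + 1) = G^I_λ Ξ(t)` (consistent with row 559).

Nothing is claimed about (N).

Blind lane: Mathlib + the HodgeRepro2 prefix only; no sorry; axioms ⊆ {propext, Classical.choice,
Quot.sound}.
-/

namespace Summit.Ventures.HodgeRepro2.T5SU11ResolventNeumannSharpRadius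

open Filter Topology MeasureTheory
open Set (Ioi Ioc)
open T5SU11Cartan T5SU11SphericalFunction T5SU11SphericalBounds T5SU11SphericalDecay T5SU11RadialGreenImproper
  T5SU11ResolventEigenfunction T5SU11WeightedSpaceGroundStateOrder T5SU11KernelCompositionDerivative

/-- `μ₂ + 1 = (λ₂ − 1)² > 0` for `λ₂ > 1`. -/
theorem mu_add_one_pos {lam₂ : ℝ} (hlam₂ : 1 < lam₂) : 0 < lam₂ * (lam₂ - 2) + 1 := by nlinarith

section measure

variable [MeasurableSpace Circle] [BorelSpace Circle]

variable {lam : ℝ} (hlam : 1 < lam)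

include hlam in
/-- **The iterates of the resolvent on the ground state**: `(G^I_λ)^k Ξ(t) = (−1/(μ + 1))^k Ξ(t)` for `t > 0`. -/
theorem iterate_sph_one (k : ℕ) :
    ∀ t, 0 < t → ((greenSolI (fun t => sph lam (hyp t)) (sphDecay lam))^[k] (fun s => sph 1 (hyp s))) t
      = (-(1 / (lam * (lam - 2) + 1))) ^ k * sph 1 (hyp t) := by
  induction k with
  | zero =>
    intro t _
    simp
  | succ k ih =>
    intro t ht
    rw [Function.iterate_succ_apply', greenSolI_congr_Ioi (fun t => sph lam (hyp t)) (sphDecay lam)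
      (g := fun r => (-(1 / (lam * (lam - 2) + 1))) ^ k * sph 1 (hyp r)) (fun r hr => ih r hr) ht,
      greenSolI_const_mul_source, greenSolI_sph_one_eq hlam ht, pow_succ]
    ring

variable {lam₂ : ℝ} (hlam₂ : 1 < lam₂)

include hlam₂ in
/-- The `k`-th term of the Neumann series on the ground state is geometric:
`(μ − μ₂)^k (G^I_{λ₂})^{k+1} Ξ(t) = −Ξ(t)/(μ₂ + 1) · (−(μ − μ₂)/(μ₂ + 1))^k`. -/
theorem neumann_sph_one_term (k : ℕ) {t : ℝ} (ht : 0 < t) :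
    (lam * (lam - 2) - lam₂ * (lam₂ - 2)) ^ k
        * ((greenSolI (fun t => sph lam₂ (hyp t)) (sphDecay lam₂))^[k + 1] (fun s => sph 1 (hyp s))) t
      = (-(1 / (lam₂ * (lam₂ - 2) + 1)) * sph 1 (hyp t))
        * (-((lam * (lam - 2) - lam₂ * (lam₂ - 2)) / (lam₂ * (lam₂ - 2) + 1))) ^ k := by
  rw [iterate_sph_one hlam₂ (k + 1) t ht, pow_succ]
  have e : -((lam * (lam - 2) - lam₂ * (lam₂ - 2)) / (lam₂ * (lam₂ - 2) + 1))
      = (lam * (lam - 2) - lam₂ * (lam₂ - 2)) * (-(1 / (lam₂ * (lam₂ - 2) + 1))) := by ring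
  rw [e, mul_pow]
  ring

include hlam₂ in
/-- **THE SHARP DISC IS EXACT ON THE GROUND STATE**: the Neumann series `Σ_k (μ − μ₂)^k (G^I_{λ₂})^{k+1} Ξ(t)` is summable if and
only if `|μ − μ₂| < (λ₂ − 1)²`, for every `t > 0`. -/
theorem summable_neumann_sph_one_iff {t : ℝ} (ht : 0 < t) :
    Summable (fun k : ℕ => (lam * (lam - 2) - lam₂ * (lam₂ - 2)) ^ k
        * ((greenSolI (fun t => sph lam₂ (hyp t)) (sphDecay lam₂))^[k + 1] (fun s => sph 1 (hyp s))) t)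
      ↔ |lam * (lam - 2) - lam₂ * (lam₂ - 2)| < (lam₂ - 1) ^ 2 := by
  have hμ : 0 < lam₂ * (lam₂ - 2) + 1 := mu_add_one_pos hlam₂
  have hΞ : 0 < sph 1 (hyp t) := sph_hyp_pos 1 t
  have hc : -(1 / (lam₂ * (lam₂ - 2) + 1)) * sph 1 (hyp t) ≠ 0 := by
    have : (1 / (lam₂ * (lam₂ - 2) + 1)) ≠ 0 := by positivity
    exact mul_ne_zero (neg_ne_zero.mpr this) hΞ.ne'
  have e : (fun k : ℕ => (lam * (lam - 2) - lam₂ * (lam₂ - 2)) ^ k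
        * ((greenSolI (fun t => sph lam₂ (hyp t)) (sphDecay lam₂))^[k + 1] (fun s => sph 1 (hyp s))) t)
      = fun k : ℕ => (-(1 / (lam₂ * (lam₂ - 2) + 1)) * sph 1 (hyp t))
        * (-((lam * (lam - 2) - lam₂ * (lam₂ - 2)) / (lam₂ * (lam₂ - 2) + 1))) ^ k := by
    funext k
    exact neumann_sph_one_term hlam₂ k ht
  rw [e, summable_mul_left_iff hc, summable_geometric_iff_norm_lt_one, Real.norm_eq_abs, abs_neg, abs_div,
    abs_of_pos hμ, div_lt_one hμ]
  have e2 : lam₂ * (lam₂ - 2) + 1 = (lam₂ - 1) ^ 2 := by ring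
  rw [e2]

include hlam₂ in
/-- **Divergence outside the sharp disc**: for `|μ − μ₂| > (λ₂ − 1)²` the Neumann series on the ground state is not summable. -/
theorem not_summable_neumann_sph_one (hq : (lam₂ - 1) ^ 2 < |lam * (lam - 2) - lam₂ * (lam₂ - 2)|) {t : ℝ} (ht : 0 < t) :
    ¬ Summable (fun k : ℕ => (lam * (lam - 2) - lam₂ * (lam₂ - 2)) ^ k
        * ((greenSolI (fun t => sph lam₂ (hyp t)) (sphDecay lam₂))^[k + 1] (fun s => sph 1 (hyp s))) t) := by
  rw [summable_neumann_sph_one_iff hlam₂ ht]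
  exact not_lt.mpr hq.le

include hlam₂ in
/-- **Inside the sharp disc the Neumann series on the ground state sums to `−Ξ(t)/(μ + 1)`**, the resolvent of `Ξ` at `μ`. -/
theorem hasSum_neumann_sph_one (hq : |lam * (lam - 2) - lam₂ * (lam₂ - 2)| < (lam₂ - 1) ^ 2) {t : ℝ} (ht : 0 < t) :
    HasSum (fun k : ℕ => (lam * (lam - 2) - lam₂ * (lam₂ - 2)) ^ k
        * ((greenSolI (fun t => sph lam₂ (hyp t)) (sphDecay lam₂))^[k + 1] (fun s => sph 1 (hyp s))) t)
      (-(sph 1 (hyp t) / (lam * (lam - 2) + 1))) := by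
  have hμ : 0 < lam₂ * (lam₂ - 2) + 1 := mu_add_one_pos hlam₂
  have e2 : lam₂ * (lam₂ - 2) + 1 = (lam₂ - 1) ^ 2 := by ring
  have hr : ‖-((lam * (lam - 2) - lam₂ * (lam₂ - 2)) / (lam₂ * (lam₂ - 2) + 1))‖ < 1 := by
    rw [Real.norm_eq_abs, abs_neg, abs_div, abs_of_pos hμ, div_lt_one hμ, e2]
    exact hq
  have e : (fun k : ℕ => (lam * (lam - 2) - lam₂ * (lam₂ - 2)) ^ k
        * ((greenSolI (fun t => sph lam₂ (hyp t)) (sphDecay lam₂))^[k + 1] (fun s => sph 1 (hyp s))) t)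
      = fun k : ℕ => (-(1 / (lam₂ * (lam₂ - 2) + 1)) * sph 1 (hyp t))
        * (-((lam * (lam - 2) - lam₂ * (lam₂ - 2)) / (lam₂ * (lam₂ - 2) + 1))) ^ k := by
    funext k
    exact neumann_sph_one_term hlam₂ k ht
  rw [e]
  have h := (hasSum_geometric_of_norm_lt_one hr).mul_left (-(1 / (lam₂ * (lam₂ - 2) + 1)) * sph 1 (hyp t))
  -- `μ + 1 > 0` inside the disc, and `−Ξ/(μ + 1) = (−Ξ/(μ₂ + 1)) · (1 + (μ − μ₂)/(μ₂ + 1))⁻¹`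
  have hlt := (abs_lt.mp hq).1
  have hμ' : lam * (lam - 2) + 1 ≠ 0 := by
    have : 0 < lam * (lam - 2) + 1 := by linarith
    exact this.ne'
  have hden : 1 - -((lam * (lam - 2) - lam₂ * (lam₂ - 2)) / (lam₂ * (lam₂ - 2) + 1))
      = (lam * (lam - 2) + 1) / (lam₂ * (lam₂ - 2) + 1) := by
    field_simp
    ring
  have hval : -(sph 1 (hyp t) / (lam * (lam - 2) + 1))
      = (-(1 / (lam₂ * (lam₂ - 2) + 1)) * sph 1 (hyp t))
        * (1 - -((lam * (lam - 2) - lam₂ * (lam₂ - 2)) / (lam₂ * (lam₂ - 2) + 1)))⁻¹ := by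
    rw [hden, inv_div]
    field_simp
  rw [hval]
  exact h

include hlam₂ in
/-- The sum of the Neumann series on the ground state inside the sharp disc. -/
theorem tsum_neumann_sph_one (hq : |lam * (lam - 2) - lam₂ * (lam₂ - 2)| < (lam₂ - 1) ^ 2) {t : ℝ} (ht : 0 < t) :
    ∑' k : ℕ, (lam * (lam - 2) - lam₂ * (lam₂ - 2)) ^ k
        * ((greenSolI (fun t => sph lam₂ (hyp t)) (sphDecay lam₂))^[k + 1] (fun s => sph 1 (hyp s))) t
      = -(sph 1 (hyp t) / (lam * (lam - 2) + 1)) :=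
  (hasSum_neumann_sph_one hlam₂ hq ht).tsum_eq

end measure

end Summit.Ventures.HodgeRepro2.T5SU11ResolventNeumannSharpRadius
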